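import Literature.NumberTheory.Automorphic.AutomorphicAnalyticVectorsGeneral
import Literature.AlgebraicGeometry.ShimuraVarieties.UnitaryBallLieDerivative
import HarnessLib

/-!
# F0-P2a · S2⁺ sub-lemma L2D (Nelson analyticity on `U(2,1)`), consumer shape `sig_L2D'` of the lead's CUT v2

Crux `H413` (route `HCCMUnconditional`, item `stmt-HodgeConjecture-24833`), line
`Cruxes/H413/Lines/F0_P2aCohIsotypicLine.lean` (stub S2⁺ `stub_archOrth_hol`), hand F0P2a-p02 (L2d).  The lead's cut
(`F0/P2a/F0P2a-p01/CUT-S2plus-signatures.v2.lean`, `sig_L2D'`) asks, in the datum-free «F3 frame» (any adelic group datum `𝒢`,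
any continuous `ι : U(2,1) →* G(𝔸_K)`, automorphic `μ`): for a Lie-stable space `W` of `ι`-smooth `L²`-representable functions with
injective class map, ANY finite family `Xf` in `𝔲(2,1)` with brackets in its real span, and ANY finite-dimensional `Tsub ≤ W` stable
under Nelson's Laplacian `∑ᵢ Xfᵢ Xfᵢ`, the orbits `t ↦ R(ι(exp tX)) [f]` (`invQuot f ∈ Tsub`, `X ∈ span_ℝ Xf`) are real analytic.
This file proves exactly that statement (`sig_L2D_holds`, type = the `sig_L2D'` body token for token) from the generic Literature
theorems ★ `IsL2LieStable.exists_norm_cl_lieHom_pow_le` (Nelson's estimate, any automorphy datum) and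
★ `IsL2LieStable.analyticAt_rightRegular_cl_of_norm_lieHom_pow_le` of `AutomorphicAnalyticVectorsGeneral`, applied to the
archimedean-only automorphy datum `{arch := u21Group, ofArch := ι, finiteAdelic := ⊥, finiteLevels := {⊥}, height := 0}` built
inside the proof (its finite part is never used by the archimedean calculus).

HC_CM is proved only modulo the printed citations until rung 0 closes.  No `sorry`, no definition.

References: Harish-Chandra, Trans. AMS 75 (1953), Lemma 34 [HarishChandraTAMS1953]; E. Nelson, Ann. Math. 70 (1959) §8 [Nelson1959].
-/

-- the mandated namespace repeats `HodgeConjecture.HodgeConjecture`, as in every `Theorems/*.lean` of this sub-problem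
set_option linter.dupNamespace false

noncomputable section

open MeasureTheory NumberField
open scoped InnerProductSpace ENNReal ComplexOrder Matrix

namespace Summit.HodgeConjecture.HodgeConjecture.Cruxes.H413.F0P2aL2dNelsonU21

open Literature.NumberTheory.Automorphic
open Literature.AlgebraicGeometry.ShimuraVarieties (BallForms.u21Group BallForms.liePMat)
open Literature.Geometry.ComplexHyperbolic.BallModel (U21)

/-- **L2D (Nelson analyticity, consumer shape `sig_L2D'`).**  F3 frame: any Lie-stable `L²`-representable space `W` of
`ι`-smooth functions with injective class map, any finite family `Xf ⊂ 𝔲(2,1)` with brackets in its real span, any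
finite-dimensional `Tsub ≤ W` stable under `∑ᵢ Xfᵢ Xfᵢ` ⇒ the orbit `t ↦ R(ι (exp tX)) [f]` is real analytic at every `t₀`,
for `invQuot f ∈ Tsub` and `X ∈ span_ℝ Xf`.  Proof: Nelson's sum-of-squares estimate on `Tsub` for the skew-symmetric operators
`φ ↦ Xfᵢ φ` (★ `IsL2LieStable.exists_norm_cl_lieHom_pow_le`) and factorial bounds ⇒ analyticity
(★ `IsL2LieStable.analyticAt_rightRegular_cl_of_norm_lieHom_pow_le`), for the archimedean-only automorphy datum `(u21Group, ι)`.
[cite: HarishChandraTAMS1953, Lemma 34 (p. 228)] [cite: Nelson1959, §8] -/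
theorem sig_L2D_holds :
  ∀ {K : Type} [Field K] [NumberField K] (𝒢 : AdelicGroupData K) (ι : ↥U21 →* 𝒢.Adelic), Continuous ι →
    ∀ (μ : Measure 𝒢.automorphicQuotient) [𝒢.IsAutomorphicMeasure μ] (W : Submodule ℂ (𝒢.Adelic → ℂ)),
    (∀ φ ∈ W, IsArchSmooth (H := BallForms.u21Group) ι φ) →
    (∀ (X : BallForms.u21Group.lie), ∀ φ ∈ W, lieDeriv (H := BallForms.u21Group) ι X φ ∈ W) →
    W ≤ 𝒢.l2Representable μ →
    (∀ φ ∈ W, ∀ (f : 𝒢.automorphicQuotient → ℂ) (hf : MemLp f 2 μ), invQuot 𝒢 f = φ → hf.toLp f = 0 → φ = 0) →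
    ∀ {I : Type} [Fintype I] (Xf : I → BallForms.u21Group.lie),
    (∀ i j, ⁅Xf i, Xf j⁆ ∈ Submodule.span ℝ (Set.range Xf)) →
    ∀ (Tsub : Submodule ℂ (𝒢.Adelic → ℂ)), Tsub ≤ W → FiniteDimensional ℂ Tsub →
    (∀ φ ∈ Tsub, (∑ i, lieDeriv (H := BallForms.u21Group) ι (Xf i) (lieDeriv (H := BallForms.u21Group) ι (Xf i) φ)) ∈ Tsub) →
    ∀ φ ∈ Tsub, ∀ (f : 𝒢.automorphicQuotient → ℂ) (hf : MemLp f 2 μ), invQuot 𝒢 f = φ →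
    ∀ X ∈ Submodule.span ℝ (Set.range Xf), ∀ t₀ : ℝ,
      AnalyticAt ℝ (fun t : ℝ => 𝒢.rightRegular μ (ι (BallForms.u21Group.expMem (t • X))) (hf.toLp f)) t₀ := by
  intro K _ _ 𝒢 ι hι μ _ W hsm hlie hrep hinj I _ Xf hbr Tsub hTW hTfin hΔ φ hφ f hf hfφ X hX t₀
  -- the archimedean-only automorphy datum attached to `ι` (finite part, levels, height unused)
  let 𝒟 : AutomorphyDatum 𝒢 ℂ (Fin 3) :=
    { arch := BallForms.u21Group
      ofArch := ι
      continuous_ofArch := hι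
      finiteAdelic := ⊥
      commute_ofArch := fun g h hh => by
        rw [Subgroup.mem_bot] at hh
        rw [hh, mul_one, one_mul]
      finiteLevels := {⊥}
      finiteLevels_nonempty := ⟨⊥, rfl⟩
      le_finiteAdelic := fun U hU => by
        rw [Set.mem_singleton_iff] at hU
        rw [hU]
      height := 0 }
  -- injectivity of the class map in the `IsL2LieStable` form
  have hinj' : ∀ (ψ : 𝒢.Adelic → ℂ) (hψ : ψ ∈ W), 𝒢.l2ClassOf μ ⟨ψ, hrep hψ⟩ = 0 → ψ = 0 := by
    intro ψ hψ h0
    exact hinj ψ hψ (𝒢.l2Rep ⟨ψ, hrep hψ⟩) (𝒢.memLp_l2Rep _) (𝒢.invQuot_l2Rep _) h0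
  have h : IsL2LieStable 𝒟 μ W := ⟨hsm, hlie, hrep, hinj'⟩
  obtain ⟨ρ, hρ⟩ := h.isLieStableSmooth.exists_lieHom
  -- `Tsub` read inside `W`
  haveI := hTfin
  let T : Submodule ℂ W := Tsub.comap W.subtype
  haveI : FiniteDimensional ℂ T :=
    LinearEquiv.finiteDimensional (Submodule.comapSubtypeEquivOfLe hTW).symm
  have hT : ∀ u ∈ T, (∑ i, ρ (Xf i) * ρ (Xf i)) u ∈ T := fun u hu => by
    change (((∑ i, ρ (Xf i) * ρ (Xf i)) u : W) : 𝒢.Adelic → ℂ) ∈ Tsub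
    rw [IsLieStableSmooth.coe_sum_lieHom_mul_lieHom_apply ρ hρ]
    exact hΔ _ hu
  -- Nelson's estimate on `T`
  obtain ⟨M, -, hM⟩ := h.exists_norm_cl_lieHom_pow_le ρ hρ Xf hbr T hT
  obtain ⟨x, hx⟩ := (Submodule.mem_span_range_iff_exists_fun ℝ).mp hX
  let φ' : W := ⟨φ, hTW hφ⟩
  have hφ' : φ' ∈ T := hφ
  have hcl : h.cl φ' = hf.toLp f := h.cl_eq_toLp hf hfφ
  rw [← hcl, ← hx]
  refine h.analyticAt_rightRegular_cl_of_norm_lieHom_pow_le ρ hρ _ φ' (C := ‖h.cl φ'‖)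
    (M := M * ∑ i, |x i|) (fun m => ?_) t₀
  calc ‖h.cl ((ρ (∑ i, x i • Xf i) ^ m) φ')‖
      ≤ (M * ∑ i, |x i|) ^ m * m.factorial * ‖h.cl φ'‖ := hM x φ' hφ' m
    _ = ‖h.cl φ'‖ * (M * ∑ i, |x i|) ^ m * m.factorial := by ring

end Summit.HodgeConjecture.HodgeConjecture.Cruxes.H413.F0P2aL2dNelsonU21

end
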